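import Mathlib
import Literature.Topology.FourManifolds.PlanarAchiralWords
import Literature.Topology.FourManifolds.PlanarShadowWalk
import Summits.SmoothPoincare4.SmoothPoincare4.Theorems.ConvexBisectionPlanarAcyclicBisectionRigidityHelperWalkThreeMoves
import HarnessLib

/-!
# Crux `ConvexBisection.PlanarAcyclicBisectionRigidity`, line Sketch v3.0 — `stub_walk3`, part 2:
# the GENERIC case up to the lift (ordered start, shadow equation, reorderings)

Combinatorics of the planar word calculus on three holes (nothing topological).  For a level-3 block
form whose positive block is `{d, c_x, c_y}` and negative block `{e, e_x, e_y}` in SOME order — `d`,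
`e` letters with the SAME central twist, `c_x`, `e_x` letters whose positive twists are evaluations of
round-sub-alphabet words with `x`-type shadows, `c_y`, `e_y` likewise of `y`-type — and equal block
monodromies, the word walks (Hurwitz moves, inverse Hurwitz moves) to the ORDERED block form
`[d′, c_x′, c_y′] · [e′, e_x′, e_y′]‾ʳᵉᵛ` (`Walk3.reorder_*`), where the shadow equation
`p_x p_y = q_x q_y` holds as soon as the `F₂` shadow is faithful (`Walk3.shadow_eq_of_monodromy_eq`,
with faithfulness a HYPOTHESIS — the registered `helper_shadow_faithful3`), so that the twist-level
lift of the lever (HYPOTHESIS — the registered `helper_twistLift3`) finishes: `Walk3.generic_ordered`,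
`Walk3.generic_xy`.  Part 3 reduces every integral homotopy-sphere word to this shape (after at most
one global conjugation) or to the degenerate commuting case.
-/

noncomputable section

open Literature.Topology.FourManifolds Literature.Topology.FourManifolds.PlanarWords
open Literature.Topology.FourManifolds.PlanarShadow (F₂ gx gy IsXYGen shadowWord shadowWord_append
  shadowWord_nil XYPairs)

-- the prescribed namespace `Summit.<S>.<P>.…` repeats `SmoothPoincare4` (S = P = SmoothPoincare4)
set_option linter.dupNamespace false

namespace Summit.SmoothPoincare4.SmoothPoincare4.Theorems.PlanarAcyclicBisectionRigidity.Sketch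

namespace Walk3

open ArcData PGen WalkLow SeamNG ReachMon Conj3

/-! ## Vocabulary of this file, as local notations (no definitions)

* `Central[d]` — the positive twist of `d` is a hole twist or the outer twist;
* `KindX c p` / `KindY c p` — the positive twist of `c` is the evaluation of a word `g` in the round
  sub-alphabet with shadow `p`, and `p` is a conjugate of `x` (resp. `y`) in `F₂`. -/

set_option quotPrecheck false in
/-- `Central[d]`: the positive twist of `d` is `T_[j,j]` for some `j` or `T_[0,2]`. [folklore] -/
local notation "Central[" d "]" => ((∃ j : Fin 3, T 3 (d, true) = U 3 [PGen.round j.val j.val false]) ∨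
  T 3 (d, true) = U 3 [PGen.round 0 2 false])

set_option quotPrecheck false in
/-- `XYData[c, p]`: the positive twist of `c` evaluates like an XY-word of shadow `p`. [folklore] -/
local notation "XYData[" c ", " p "]" => (∃ g : List PGen, (∀ q ∈ g, IsXYGen q) ∧ shadowWord g = p ∧
  evalWord 3 (PlanarCurve.twistWord c true) = evalWord 3 g)

set_option quotPrecheck false in
/-- `ConjX[p]`: `p` is a conjugate of `x` in `F₂`. [folklore] -/
local notation "ConjX[" p "]" => (∃ u : F₂, p = u * gx * u⁻¹)

set_option quotPrecheck false in
/-- `ConjY[p]`: `p` is a conjugate of `y` in `F₂`. [folklore] -/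
local notation "ConjY[" p "]" => (∃ u : F₂, p = u * gy * u⁻¹)

/-! ## Conjugates of conjugates -/

/-- A conjugate of a conjugate of `x` is a conjugate of `x`. [folklore] -/
theorem conjX_conj {p : F₂} (hp : ConjX[p]) (v : F₂) : ConjX[(v * p * v⁻¹)] := by
  obtain ⟨u, rfl⟩ := hp; exact ⟨v * u, by group⟩

/-- A conjugate of a conjugate of `y` is a conjugate of `y`. [folklore] -/
theorem conjY_conj {p : F₂} (hp : ConjY[p]) (v : F₂) : ConjY[(v * p * v⁻¹)] := by
  obtain ⟨u, rfl⟩ := hp; exact ⟨v * u, by group⟩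

/-! ## The shadow equation of an ordered generic block pair -/

/-- The unit of the monodromy of a three-letter positive block is the ordered product of the three
twist units. [folklore] -/
theorem M_three (a b c : PlanarCurve) :
    M 3 (positiveWord [a, b, c]) = T 3 (a, true) * T 3 (b, true) * T 3 (c, true) := by
  rw [positiveWord_cons, M_cons, positiveWord_cons, M_cons, positiveWord_cons, M_cons]
  rw [show positiveWord ([] : List PlanarCurve) = [] from rfl, M_nil, mul_one, mul_assoc]

/-- **The shadow equation.**  If `[d, c_x, c_y]` and `[e, e_x, e_y]` have equal monodromies, `d` and
`e` have the same twist, and the essential letters carry XY-data with shadows `p_x, p_y, q_x, q_y`,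
then `p_x p_y = q_x q_y` — PROVIDED the `F₂` shadow is faithful (hypothesis `hF`, the registered
`helper_shadow_faithful3`). [folklore] -/
theorem shadow_eq_of_monodromy_eq
    (hF : ∀ (g h : List PGen), (∀ q ∈ g, IsXYGen q) → (∀ q ∈ h, IsXYGen q) →
      evalWord 3 g = evalWord 3 h → shadowWord g = shadowWord h)
    {d cx cy e ex ey : PlanarCurve} {px py qx qy : F₂}
    (hde : T 3 (d, true) = T 3 (e, true))
    (hcx : XYData[cx, px]) (hcy : XYData[cy, py]) (hex : XYData[ex, qx]) (hey : XYData[ey, qy])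
    (hmon : monodromy 3 (positiveWord [d, cx, cy]) = monodromy 3 (positiveWord [e, ex, ey])) :
    px * py = qx * qy := by
  obtain ⟨gx', hgx, rfl, hx⟩ := hcx
  obtain ⟨gy', hgy, rfl, hy⟩ := hcy
  obtain ⟨hx', hhx, rfl, hx2⟩ := hex
  obtain ⟨hy', hhy, rfl, hy2⟩ := hey
  -- units: `T_d U_{gx} U_{gy} = T_e U_{hx} U_{hy}`
  have hM : M 3 (positiveWord [d, cx, cy]) = M 3 (positiveWord [e, ex, ey]) := Units.ext hmon
  rw [M_three, M_three, hde, T_eq_U_of_eval hx, T_eq_U_of_eval hy, T_eq_U_of_eval hx2,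
    T_eq_U_of_eval hy2, mul_assoc, mul_assoc] at hM
  have hM' : U 3 (gx' ++ gy') = U 3 (hx' ++ hy') := by
    rw [U_append, U_append]; exact mul_left_cancel hM
  have h := hF (gx' ++ gy') (hx' ++ hy')
    (fun q hq => (List.mem_append.1 hq).elim (hgx q) (hgy q))
    (fun q hq => (List.mem_append.1 hq).elim (hhx q) (hhy q)) (congrArg Units.val hM')
  rwa [shadowWord_append, shadowWord_append] at h

/-! ## The ordered generic case: the lift finishes -/

/-- **THE ORDERED GENERIC CASE.**  For the block form `[d, c_x, c_y] · [e, e_x, e_y]‾ʳᵉᵛ` with `T_d = T_e`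
central, `x`-data on `c_x, e_x`, `y`-data on `c_y, e_y` and equal block monodromies, the walk reaches
an honest double — given faithfulness of the shadow (`hF`) and the twist-level lift (`hL`, the
registered `helper_twistLift3`). [folklore] -/
theorem generic_ordered
    (hF : ∀ (g h : List PGen), (∀ q ∈ g, IsXYGen q) → (∀ q ∈ h, IsXYGen q) →
      evalWord 3 g = evalWord 3 h → shadowWord g = shadowWord h)
    (hL : ∀ (dA dB a₁ a₂ b₁ b₂ : PlanarCurve) (w p₁ p₂ q₁ q₂ : F₂),
      evalWord 3 (dA.twistWord true) = evalWord 3 (dB.twistWord true) →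
      (p₁, p₂) ∈ XYPairs w → (q₁, q₂) ∈ XYPairs w →
      XYData[a₁, p₁] → XYData[a₂, p₂] → XYData[b₁, q₁] → XYData[b₂, q₂] →
      ∃ A' B' : List PlanarCurve,
        Reachable (3, blockForm [dA, a₁, a₂] [dB, b₁, b₂]) (3, blockForm A' B') ∧ TwistEq 3 A' B')
    {d cx cy e ex ey : PlanarCurve} {px py qx qy : F₂}
    (hde : T 3 (d, true) = T 3 (e, true))
    (hcx : XYData[cx, px]) (hcy : XYData[cy, py]) (hex : XYData[ex, qx]) (hey : XYData[ey, qy])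
    (hpx : ConjX[px]) (hpy : ConjY[py]) (hqx : ConjX[qx]) (hqy : ConjY[qy])
    (hmon : monodromy 3 (positiveWord [d, cx, cy]) = monodromy 3 (positiveWord [e, ex, ey])) :
    ∃ A' B' : List PlanarCurve,
      Reachable (3, blockForm [d, cx, cy] [e, ex, ey]) (3, blockForm A' B') ∧ TwistEq 3 A' B' := by
  have hw : px * py = qx * qy := shadow_eq_of_monodromy_eq hF hde hcx hcy hex hey hmon
  obtain ⟨ux, hux⟩ := hpx
  obtain ⟨uy, huy⟩ := hpy
  obtain ⟨vx, hvx⟩ := hqx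
  obtain ⟨vy, hvy⟩ := hqy
  exact hL d e cx cy ex ey (px * py) px py qx qy (congrArg Units.val hde)
    ⟨⟨ux, hux⟩, ⟨uy, huy⟩, rfl⟩ ⟨⟨vx, hvx⟩, ⟨vy, hvy⟩, hw.symm⟩ hcx hcy hex hey

/-! ## Reordering the positive block to `[d, c_x, c_y]` -/

/-- Bringing a central letter from position 1 to the front of a three-letter positive block; the
other letters are untouched. [folklore] -/
theorem central_to_front₁ {a d b : PlanarCurve} (hd : Central[d]) (ha : a.InRange 3)
    (hdr : d.InRange 3) (tail : List Letter) :
    ∃ d' : PlanarCurve, T 3 (d', true) = T 3 (d, true) ∧ d'.InRange 3 ∧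
      Reachable (3, [(a, true), (d, true), (b, true)] ++ tail) (3, [(d', true), (a, true), (b, true)] ++ tail) := by
  obtain ⟨d', h2, hT, hr, hreach⟩ :=
    move_central_left [] ((b, true) :: tail) (a, true) (d, true) hd ha hdr
  obtain ⟨dc, ds⟩ := d'
  simp only at h2 hT hr
  subst h2
  exact ⟨dc, hT, hr, by simpa using hreach⟩

/-- Bringing a central letter from position 2 to the front of a three-letter positive block; the
other letters are untouched. [folklore] -/
theorem central_to_front₂ {a b d : PlanarCurve} (hd : Central[d]) (ha : a.InRange 3) (hb : b.InRange 3)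
    (hdr : d.InRange 3) (tail : List Letter) :
    ∃ d' : PlanarCurve, T 3 (d', true) = T 3 (d, true) ∧ d'.InRange 3 ∧
      Reachable (3, [(a, true), (b, true), (d, true)] ++ tail) (3, [(d', true), (a, true), (b, true)] ++ tail) := by
  -- one step left past `b`
  obtain ⟨d₁, h2, hT₁, hr₁, hreach₁⟩ :=
    move_central_left [(a, true)] tail (b, true) (d, true) hd hb hdr
  obtain ⟨dc₁, ds₁⟩ := d₁
  simp only at h2 hT₁ hr₁
  subst h2
  -- then past `a`
  have hd₁ : Central[dc₁] := by rw [hT₁]; exact hd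
  obtain ⟨d₂, hT₂, hr₂, hreach₂⟩ := central_to_front₁ (b := b) hd₁ ha hr₁ tail
  refine ⟨d₂, hT₂.trans hT₁, hr₂, WalkLevel3.reach_trans ?_ hreach₂⟩
  simpa using hreach₁

/-- **Reordering the positive block.**  A three-letter positive block consisting of a central letter
`d` and two letters with `x`- and `y`-data, in ANY order, walks to `[d′, c_x′, c_y′]` with
`T_{d′} = T_d` and fresh `x`- and `y`-data; the tail is untouched. [folklore] -/
theorem reorder_pos {L : List PlanarCurve} {d cx cy : PlanarCurve} {px py : F₂}
    (hL : L = [d, cx, cy] ∨ L = [d, cy, cx] ∨ L = [cx, d, cy] ∨ L = [cy, d, cx] ∨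
      L = [cx, cy, d] ∨ L = [cy, cx, d])
    (hd : Central[d]) (hcx : XYData[cx, px]) (hcy : XYData[cy, py]) (hpx : ConjX[px]) (hpy : ConjY[py])
    (hdr : d.InRange 3) (hcxr : cx.InRange 3) (hcyr : cy.InRange 3) (tail : List Letter) :
    ∃ (d' cx' cy' : PlanarCurve) (px' py' : F₂), T 3 (d', true) = T 3 (d, true) ∧
      XYData[cx', px'] ∧ XYData[cy', py'] ∧ ConjX[px'] ∧ ConjY[py'] ∧
      d'.InRange 3 ∧ cx'.InRange 3 ∧ cy'.InRange 3 ∧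
      Reachable (3, positiveWord L ++ tail) (3, positiveWord [d', cx', cy'] ++ tail) := by
  -- Step 1: central letter to the front, essentials keep order `(u, v)`
  have step1 : ∀ (u v : PlanarCurve), u.InRange 3 → v.InRange 3 →
      (L = [d, u, v] ∨ L = [u, d, v] ∨ L = [u, v, d]) →
      ∃ d' : PlanarCurve, T 3 (d', true) = T 3 (d, true) ∧ d'.InRange 3 ∧
        Reachable (3, positiveWord L ++ tail) (3, positiveWord [d', u, v] ++ tail) := by
    intro u v hu hv hL3
    rcases hL3 with rfl | rfl | rfl
    · exact ⟨d, rfl, hdr, Reachable.refl _⟩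
    · obtain ⟨d', hT, hr, h⟩ := central_to_front₁ (b := v) hd hu hdr tail
      exact ⟨d', hT, hr, by simpa [positiveWord] using h⟩
    · obtain ⟨d', hT, hr, h⟩ := central_to_front₂ hd hu hv hdr tail
      exact ⟨d', hT, hr, by simpa [positiveWord] using h⟩
  -- Step 2: if the essentials read `(c_y, c_x)`, one Hurwitz move swaps them
  rcases hL with h | h | h | h | h | h
  · exact ⟨d, cx, cy, px, py, rfl, hcx, hcy, hpx, hpy, hdr, hcxr, hcyr, h ▸ Reachable.refl _⟩
  · obtain ⟨d', hT, hr, hreach⟩ := step1 cy cx hcyr hcxr (Or.inl h)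
    obtain ⟨gy', hgy, hsy, hy⟩ := hcy
    obtain ⟨gx', hgx, hsx, hx⟩ := hcx
    obtain ⟨cx', hcx'r, hev, hxy, hsw, hsw2⟩ :=
      swap_pos [(d', true)] tail cy cx gy' gx' hgy hgx hy hx hcyr hcxr
    refine ⟨d', cx', cy, shadowWord gy' * px * (shadowWord gy')⁻¹, py, hT,
      ⟨_, hxy, by rw [hsw, hsx], hev⟩, ⟨gy', hgy, hsy, hy⟩, conjX_conj hpx _, hpy, hr, hcx'r, hcyr,
      WalkLevel3.reach_trans hreach ?_⟩
    simpa [positiveWord] using hsw2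
  · obtain ⟨d', hT, hr, hreach⟩ := step1 cx cy hcxr hcyr (Or.inr (Or.inl h))
    exact ⟨d', cx, cy, px, py, hT, hcx, hcy, hpx, hpy, hr, hcxr, hcyr, hreach⟩
  · obtain ⟨d', hT, hr, hreach⟩ := step1 cy cx hcyr hcxr (Or.inr (Or.inl h))
    obtain ⟨gy', hgy, hsy, hy⟩ := hcy
    obtain ⟨gx', hgx, hsx, hx⟩ := hcx
    obtain ⟨cx', hcx'r, hev, hxy, hsw, hsw2⟩ :=
      swap_pos [(d', true)] tail cy cx gy' gx' hgy hgx hy hx hcyr hcxr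
    refine ⟨d', cx', cy, shadowWord gy' * px * (shadowWord gy')⁻¹, py, hT,
      ⟨_, hxy, by rw [hsw, hsx], hev⟩, ⟨gy', hgy, hsy, hy⟩, conjX_conj hpx _, hpy, hr, hcx'r, hcyr,
      WalkLevel3.reach_trans hreach ?_⟩
    simpa [positiveWord] using hsw2
  · obtain ⟨d', hT, hr, hreach⟩ := step1 cx cy hcxr hcyr (Or.inr (Or.inr h))
    exact ⟨d', cx, cy, px, py, hT, hcx, hcy, hpx, hpy, hr, hcxr, hcyr, hreach⟩
  · obtain ⟨d', hT, hr, hreach⟩ := step1 cy cx hcyr hcxr (Or.inr (Or.inr h))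
    obtain ⟨gy', hgy, hsy, hy⟩ := hcy
    obtain ⟨gx', hgx, hsx, hx⟩ := hcx
    obtain ⟨cx', hcx'r, hev, hxy, hsw, hsw2⟩ :=
      swap_pos [(d', true)] tail cy cx gy' gx' hgy hgx hy hx hcyr hcxr
    refine ⟨d', cx', cy, shadowWord gy' * px * (shadowWord gy')⁻¹, py, hT,
      ⟨_, hxy, by rw [hsw, hsx], hev⟩, ⟨gy', hgy, hsy, hy⟩, conjX_conj hpx _, hpy, hr, hcx'r, hcyr,
      WalkLevel3.reach_trans hreach ?_⟩
    simpa [positiveWord] using hsw2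

/-! ## Reordering the negative block to `[(e_y, ff), (e_x, ff), (e, ff)]` -/

/-- Bringing a central negative letter from position 1 of the tail to its end; the other letters
are untouched. [folklore] -/
theorem central_to_back₁ (head : List Letter) {a e b : PlanarCurve} (he : Central[e])
    (hb : b.InRange 3) (her : e.InRange 3) :
    ∃ e' : PlanarCurve, T 3 (e', true) = T 3 (e, true) ∧ e'.InRange 3 ∧
      Reachable (3, head ++ [(a, false), (e, false), (b, false)])
        (3, head ++ [(a, false), (b, false), (e', false)]) := by
  obtain ⟨e', h2, hT, hr, hreach⟩ :=
    move_central_right (head ++ [(a, false)]) [] (e, false) (b, false) he hb her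
  obtain ⟨ec, es⟩ := e'
  simp only at h2 hT hr
  subst h2
  exact ⟨ec, hT, hr, by simpa using hreach⟩

/-- Bringing a central negative letter from position 0 of the tail to its end; the other letters are
untouched. [folklore] -/
theorem central_to_back₀ (head : List Letter) {e a b : PlanarCurve} (he : Central[e])
    (ha : a.InRange 3) (hb : b.InRange 3) (her : e.InRange 3) :
    ∃ e' : PlanarCurve, T 3 (e', true) = T 3 (e, true) ∧ e'.InRange 3 ∧
      Reachable (3, head ++ [(e, false), (a, false), (b, false)])
        (3, head ++ [(a, false), (b, false), (e', false)]) := by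
  obtain ⟨e₁, h2, hT₁, hr₁, hreach₁⟩ :=
    move_central_right head [(b, false)] (e, false) (a, false) he ha her
  obtain ⟨ec₁, es₁⟩ := e₁
  simp only at h2 hT₁ hr₁
  subst h2
  have he₁ : Central[ec₁] := by rw [hT₁]; exact he
  obtain ⟨e₂, hT₂, hr₂, hreach₂⟩ := central_to_back₁ head (a := a) he₁ hb hr₁
  refine ⟨e₂, hT₂.trans hT₁, hr₂, WalkLevel3.reach_trans ?_ hreach₂⟩
  simpa using hreach₁

/-- The negative block of a block form, for a three-letter block (definitional unfolding).
[folklore] -/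
theorem blockForm_three (A : List PlanarCurve) (e₁ e₂ e₃ : PlanarCurve) :
    blockForm A [e₁, e₂, e₃] = positiveWord A ++ [(e₃, false), (e₂, false), (e₁, false)] := by
  simp [blockForm]

/-- **Reordering the negative block.**  With the positive block `H` fixed, a three-letter negative
block consisting of a central `e` and letters with `x`- and `y`-data, in ANY order, walks to the block
form of `[e′, e_x′, e_y′]`, i.e. to the tail `[(e_y′, ff), (e_x′, ff), (e′, ff)]`. [folklore] -/
theorem reorder_neg (A : List PlanarCurve) {B : List PlanarCurve} {e ex ey : PlanarCurve} {qx qy : F₂}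
    (hB : B = [e, ex, ey] ∨ B = [e, ey, ex] ∨ B = [ex, e, ey] ∨ B = [ey, e, ex] ∨
      B = [ex, ey, e] ∨ B = [ey, ex, e])
    (he : Central[e]) (hex : XYData[ex, qx]) (hey : XYData[ey, qy]) (hqx : ConjX[qx]) (hqy : ConjY[qy])
    (her : e.InRange 3) (hexr : ex.InRange 3) (heyr : ey.InRange 3) :
    ∃ (e' ex' ey' : PlanarCurve) (qx' qy' : F₂), T 3 (e', true) = T 3 (e, true) ∧
      XYData[ex', qx'] ∧ XYData[ey', qy'] ∧ ConjX[qx'] ∧ ConjY[qy'] ∧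
      e'.InRange 3 ∧ ex'.InRange 3 ∧ ey'.InRange 3 ∧
      Reachable (3, blockForm A B) (3, blockForm A [e', ex', ey']) := by
  -- the tail of `blockForm A [b₁, b₂, b₃]` is `[(b₃,ff), (b₂,ff), (b₁,ff)]`
  -- Step 1: central letter to the END of the tail, essentials keep their tail order `(u, v)`
  have step1 : ∀ (u v : PlanarCurve), u.InRange 3 → v.InRange 3 →
      (B = [e, v, u] ∨ B = [v, e, u] ∨ B = [v, u, e]) →
      ∃ e' : PlanarCurve, T 3 (e', true) = T 3 (e, true) ∧ e'.InRange 3 ∧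
        Reachable (3, blockForm A B) (3, positiveWord A ++ [(u, false), (v, false), (e', false)]) := by
    intro u v hu hv hB3
    rcases hB3 with rfl | rfl | rfl
    · -- tail `[(u,ff),(v,ff),(e,ff)]`: already at the end
      exact ⟨e, rfl, her, by rw [blockForm_three]; exact Reachable.refl _⟩
    · -- tail `[(u,ff),(e,ff),(v,ff)]`
      obtain ⟨e', hT, hr, h⟩ := central_to_back₁ (positiveWord A) (a := u) he hv her
      exact ⟨e', hT, hr, by rw [blockForm_three]; exact h⟩
    · -- tail `[(e,ff),(u,ff),(v,ff)]`
      obtain ⟨e', hT, hr, h⟩ := central_to_back₀ (positiveWord A) he hu hv her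
      exact ⟨e', hT, hr, by rw [blockForm_three]; exact h⟩
  -- Step 2: the tail must read `[(e_y,ff), (e_x,ff), (e′,ff)]`; if it reads `[(e_x,ff),(e_y,ff),…]`, swap
  have finish_ok : ∀ e' : PlanarCurve, T 3 (e', true) = T 3 (e, true) → e'.InRange 3 →
      Reachable (3, blockForm A B) (3, positiveWord A ++ [(ey, false), (ex, false), (e', false)]) →
      ∃ (e' ex' ey' : PlanarCurve) (qx' qy' : F₂), T 3 (e', true) = T 3 (e, true) ∧
        XYData[ex', qx'] ∧ XYData[ey', qy'] ∧ ConjX[qx'] ∧ ConjY[qy'] ∧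
        e'.InRange 3 ∧ ex'.InRange 3 ∧ ey'.InRange 3 ∧
        Reachable (3, blockForm A B) (3, blockForm A [e', ex', ey']) := fun e' hT hr h =>
    ⟨e', ex, ey, qx, qy, hT, hex, hey, hqx, hqy, hr, hexr, heyr, by rw [blockForm_three]; exact h⟩
  have finish_swap : ∀ e' : PlanarCurve, T 3 (e', true) = T 3 (e, true) → e'.InRange 3 →
      Reachable (3, blockForm A B) (3, positiveWord A ++ [(ex, false), (ey, false), (e', false)]) →
      ∃ (e' ex' ey' : PlanarCurve) (qx' qy' : F₂), T 3 (e', true) = T 3 (e, true) ∧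
        XYData[ex', qx'] ∧ XYData[ey', qy'] ∧ ConjX[qx'] ∧ ConjY[qy'] ∧
        e'.InRange 3 ∧ ex'.InRange 3 ∧ ey'.InRange 3 ∧
        Reachable (3, blockForm A B) (3, blockForm A [e', ex', ey']) := by
    intro e' hT hr h
    obtain ⟨gx', hgx, hsx, hx⟩ := hex
    obtain ⟨gy', hgy, hsy, hy⟩ := hey
    obtain ⟨ey', hey'r, hev, hxy, hsw, hsw2⟩ :=
      swap_neg (positiveWord A) [(e', false)] ex ey gx' gy' hgx hgy hx hy hexr heyr
    refine ⟨e', ex, ey', qx, (shadowWord gx')⁻¹ * qy * shadowWord gx', hT, ⟨gx', hgx, hsx, hx⟩,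
      ⟨_, hxy, by rw [hsw, hsy], hev⟩, hqx, ?_, hr, hexr, hey'r, ?_⟩
    · have := conjY_conj hqy (shadowWord gx')⁻¹
      rwa [_root_.inv_inv] at this
    · rw [blockForm_three]
      exact WalkLevel3.reach_trans h (by simpa using hsw2)
  rcases hB with h | h | h | h | h | h
  · obtain ⟨e', hT, hr, hreach⟩ := step1 ey ex heyr hexr (Or.inl h)
    exact finish_ok e' hT hr hreach
  · obtain ⟨e', hT, hr, hreach⟩ := step1 ex ey hexr heyr (Or.inl h)
    exact finish_swap e' hT hr hreach
  · obtain ⟨e', hT, hr, hreach⟩ := step1 ey ex heyr hexr (Or.inr (Or.inl h))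
    exact finish_ok e' hT hr hreach
  · obtain ⟨e', hT, hr, hreach⟩ := step1 ex ey hexr heyr (Or.inr (Or.inl h))
    exact finish_swap e' hT hr hreach
  · obtain ⟨e', hT, hr, hreach⟩ := step1 ey ex heyr hexr (Or.inr (Or.inr h))
    exact finish_ok e' hT hr hreach
  · obtain ⟨e', hT, hr, hreach⟩ := step1 ex ey hexr heyr (Or.inr (Or.inr h))
    exact finish_swap e' hT hr hreach

/-! ## The generic `{x, y}` case in any order -/

/-- Equal block monodromies are transported along the orbit (total monodromy `1` is an orbit
invariant, `ReachMon.reachable_iff`). [folklore] -/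
theorem monodromy_eq_of_reachable {A B A' B' : List PlanarCurve}
    (hmon : monodromy 3 (positiveWord A) = monodromy 3 (positiveWord B))
    (hr : Reachable (3, blockForm A B) (3, blockForm A' B')) :
    monodromy 3 (positiveWord A') = monodromy 3 (positiveWord B') :=
  (blockForm_one_iff A' B').1 ((reachable_iff hr).1 ((blockForm_one_iff A B).2 hmon))

/-- **THE GENERIC `{x, y}` CASE.**  Positive block `{d, c_x, c_y}` and negative block `{e, e_x, e_y}`
in any orders, `T_d = T_e` central, `x`- and `y`-data as stated, equal block monodromies: the walk reaches
an honest double (given `hF`, `hL`).  Reorder both blocks (central letters to the ends, one swap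
each if needed), transport the monodromy equation, apply the ordered case. [folklore] -/
theorem generic_xy
    (hF : ∀ (g h : List PGen), (∀ q ∈ g, IsXYGen q) → (∀ q ∈ h, IsXYGen q) →
      evalWord 3 g = evalWord 3 h → shadowWord g = shadowWord h)
    (hL : ∀ (dA dB a₁ a₂ b₁ b₂ : PlanarCurve) (w p₁ p₂ q₁ q₂ : F₂),
      evalWord 3 (dA.twistWord true) = evalWord 3 (dB.twistWord true) →
      (p₁, p₂) ∈ XYPairs w → (q₁, q₂) ∈ XYPairs w →
      XYData[a₁, p₁] → XYData[a₂, p₂] → XYData[b₁, q₁] → XYData[b₂, q₂] →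
      ∃ A' B' : List PlanarCurve,
        Reachable (3, blockForm [dA, a₁, a₂] [dB, b₁, b₂]) (3, blockForm A' B') ∧ TwistEq 3 A' B')
    {A B : List PlanarCurve} {d cx cy e ex ey : PlanarCurve} {px py qx qy : F₂}
    (hA : A = [d, cx, cy] ∨ A = [d, cy, cx] ∨ A = [cx, d, cy] ∨ A = [cy, d, cx] ∨
      A = [cx, cy, d] ∨ A = [cy, cx, d])
    (hB : B = [e, ex, ey] ∨ B = [e, ey, ex] ∨ B = [ex, e, ey] ∨ B = [ey, e, ex] ∨
      B = [ex, ey, e] ∨ B = [ey, ex, e])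
    (hd : Central[d]) (he : Central[e]) (hde : T 3 (d, true) = T 3 (e, true))
    (hcx : XYData[cx, px]) (hcy : XYData[cy, py]) (hex : XYData[ex, qx]) (hey : XYData[ey, qy])
    (hpx : ConjX[px]) (hpy : ConjY[py]) (hqx : ConjX[qx]) (hqy : ConjY[qy])
    (hdr : d.InRange 3) (hcxr : cx.InRange 3) (hcyr : cy.InRange 3)
    (her : e.InRange 3) (hexr : ex.InRange 3) (heyr : ey.InRange 3)
    (hmon : monodromy 3 (positiveWord A) = monodromy 3 (positiveWord B)) :
    ∃ A' B' : List PlanarCurve, Reachable (3, blockForm A B) (3, blockForm A' B') ∧ TwistEq 3 A' B' := by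
  -- reorder the positive block (tail = the negative letters of `B`, untouched)
  obtain ⟨d', cx', cy', px', py', hTd, hcx', hcy', hpx', hpy', hd'r, hcx'r, hcy'r, hreach₁⟩ :=
    reorder_pos hA hd hcx hcy hpx hpy hdr hcxr hcyr ((B.map fun c => (c, false)).reverse)
  have hreach₁' : Reachable (3, blockForm A B) (3, blockForm [d', cx', cy'] B) := hreach₁
  -- reorder the negative block
  obtain ⟨e', ex', ey', qx', qy', hTe, hex', hey', hqx', hqy', he'r, hex'r, hey'r, hreach₂⟩ :=
    reorder_neg [d', cx', cy'] hB he hex hey hqx hqy her hexr heyr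
  have hreach : Reachable (3, blockForm A B) (3, blockForm [d', cx', cy'] [e', ex', ey']) :=
    WalkLevel3.reach_trans hreach₁' hreach₂
  -- transport the monodromy equation and finish with the ordered case
  have hmon' := monodromy_eq_of_reachable hmon hreach
  obtain ⟨A', B', hr, hte⟩ := generic_ordered hF hL (hTd.trans (hde.trans hTe.symm)) hcx' hcy' hex'
    hey' hpx' hpy' hqx' hqy' hmon'
  exact ⟨A', B', WalkLevel3.reach_trans hreach hr, hte⟩

end Walk3

open ReachMon in
/-- **Registered helper `helper_walk3_genericXY`** (= `Walk3.generic_xy`, the form the ledger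
records, notations expanded): the generic `{x, y}` case of `stub_walk3` in any order of the two
blocks, given faithfulness of the `F₂` shadow (`hF`) and the twist-level lift (`hL`). [folklore] -/
theorem helper_walk3_genericXY (hF : ∀ (g h : List PGen), (∀ q ∈ g, IsXYGen q) → (∀ q ∈ h, IsXYGen q) → evalWord 3 g = evalWord 3 h → shadowWord g = shadowWord h) (hL : ∀ (dA dB a₁ a₂ b₁ b₂ : PlanarCurve) (w p₁ p₂ q₁ q₂ : F₂), evalWord 3 (dA.twistWord true) = evalWord 3 (dB.twistWord true) → (p₁, p₂) ∈ XYPairs w → (q₁, q₂) ∈ XYPairs w → (∃ g : List PGen, (∀ q ∈ g, IsXYGen q) ∧ shadowWord g = p₁ ∧ evalWord 3 (PlanarCurve.twistWord a₁ true) = evalWord 3 g) → (∃ g : List PGen, (∀ q ∈ g, IsXYGen q) ∧ shadowWord g = p₂ ∧ evalWord 3 (PlanarCurve.twistWord a₂ true) = evalWord 3 g) → (∃ g : List PGen, (∀ q ∈ g, IsXYGen q) ∧ shadowWord g = q₁ ∧ evalWord 3 (PlanarCurve.twistWord b₁ true) = evalWord 3 g) → (∃ g : List PGen, (∀ q ∈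 g, IsXYGen q) ∧ shadowWord g = q₂ ∧ evalWord 3 (PlanarCurve.twistWord b₂ true) = evalWord 3 g) → ∃ A' B' : List PlanarCurve, Reachable (3, blockForm [dA, a₁, a₂] [dB, b₁, b₂]) (3, blockForm A' B') ∧ TwistEq 3 A' B') (A B : List PlanarCurve) (d cx cy e ex ey : PlanarCurve) (px py qx qy : F₂) (hA : A = [d, cx, cy] ∨ A = [d, cy, cx] ∨ A = [cx, d, cy] ∨ A = [cy, d, cx] ∨ A = [cx, cy, d] ∨ A = [cy, cx, d]) (hB : B = [e, ex, ey] ∨ B = [e, ey, ex] ∨ B = [ex, e, ey] ∨ B = [ey, e, ex] ∨ B = [ex, ey, e] ∨ B = [ey, ex, e]) (hd : ((∃ j : Fin 3, T 3 (d, true) = U 3 [PGen.round j.val j.val false]) ∨ T 3 (d, true) = U 3 [PGen.round 0 2 false])) (he : ((∃ j : Fin 3, T 3 (e, true) = U 3 [PGen.round j.val j.val false]) ∨ T 3 (e, true) = U 3 [PGen.round 0 2 false])) (hde : T 3 (d, true) = T 3 (e, true)) (hcx : (∃ g : List PGen, (∀ q ∈ g, IsXYGen q) ∧ shadowWord g =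 px ∧ evalWord 3 (PlanarCurve.twistWord cx true) = evalWord 3 g)) (hcy : (∃ g : List PGen, (∀ q ∈ g, IsXYGen q) ∧ shadowWord g = py ∧ evalWord 3 (PlanarCurve.twistWord cy true) = evalWord 3 g)) (hex : (∃ g : List PGen, (∀ q ∈ g, IsXYGen q) ∧ shadowWord g = qx ∧ evalWord 3 (PlanarCurve.twistWord ex true) = evalWord 3 g)) (hey : (∃ g : List PGen, (∀ q ∈ g, IsXYGen q) ∧ shadowWord g = qy ∧ evalWord 3 (PlanarCurve.twistWord ey true) = evalWord 3 g)) (hpx : ∃ u : F₂, px = u * gx * u⁻¹) (hpy : ∃ u : F₂, py = u * gy * u⁻¹) (hqx : ∃ u : F₂, qx = u * gx * u⁻¹) (hqy : ∃ u : F₂, qy = u * gy * u⁻¹) (hdr : d.InRange 3) (hcxr : cx.InRange 3) (hcyr : cy.InRange 3) (her : e.InRange 3) (hexr : ex.InRange 3) (heyr : ey.InRange 3) (hmon : monodromy 3 (positiveWord A) = monodromy 3 (positiveWord B)) : ∃ A' B' : List PlanarCurve, Reachable (3, blockForm A B) (3, blockForm A' B') ∧ TwistEq 3 A' B' :=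
  Walk3.generic_xy hF hL hA hB hd he hde hcx hcy hex hey hpx hpy hqx hqy hdr hcxr hcyr her hexr heyr hmon

end Summit.SmoothPoincare4.SmoothPoincare4.Theorems.PlanarAcyclicBisectionRigidity.Sketch

end
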